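import Summits.Ventures.HodgeRepro2.T5SU11ResolventIterateDerivative
import Summits.Ventures.HodgeRepro2.T5SU11ResolventDerivativeMu

/-!
# The iterated derivatives of the resolvent: `dᵏ/dμᵏ (L − μ)⁻¹ g = k! (L − μ)^{−k−1} g` on `W_1`

In the spectral variable `μ`, with `λ(μ) = 1 + √(μ + 1)`, row 569's derivative of the iterates reads
`d/dμ (L − μ)^{−n} g = n (L − μ)^{−n−1} g`; iterating,

* `hasDerivAt_iterate_mu` — **`μ ↦ (G^I_{λ(μ)})ⁿ g(t)` has derivative `n (G^I_{λ(μ₂)})^{n+1} g(t)`** at every `μ₂ > −1`;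
* `iteratedDeriv_resolvent_mu` — **`iteratedDeriv k (μ ↦ G^I_{λ(μ)} g(t)) μ₂ = k! · (G^I_{λ(μ₂)})^{k+1} g(t)`** for every
  `k` and `μ₂ > −1`: the Taylor coefficients of the resolvent at `μ₂` are its iterates, `dᵏ/dμᵏ (L − μ)⁻¹/k! = (L − μ)^{−k−1}` —
  exactly the coefficients of row 559's power series `Σ (μ − μ₂)^k (G^I_{λ₂})^{k+1} g`;
* `iteratedDeriv_resolvent_mu'` — the same at `μ₂ = λ₂(λ₂ − 2)` in terms of `λ₂ > 1`.

Nothing is claimed about (N).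

Blind lane: Mathlib + the HodgeRepro2 prefix only; no sorry; axioms ⊆ {propext, Classical.choice,
Quot.sound}.
-/

namespace Summit.Ventures.HodgeRepro2.T5SU11ResolventIteratedDerivative

open Filter Topology MeasureTheory
open Set (Ioi Ioc)
open T5SU11Cartan T5SU11SphericalFunction T5SU11SphericalDecay T5SU11RadialGreenImproper
  T5SU11ResolventDerivativeMu T5SU11ResolventIterateDerivative

section measure

variable [MeasurableSpace Circle] [BorelSpace Circle]

variable {g : ℝ → ℝ} (hg : ContinuousOn g (Ioi 0)) {D : ℝ} (hD : ∀ s, 0 < s → |g s| ≤ D * sph 1 (hyp s))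

include hg hD in
/-- **`d/dμ (L − μ)^{−n} g = n (L − μ)^{−n−1} g`** on `W_1`: `μ ↦ (G^I_{1+√(μ+1)})ⁿ g(t)` has the derivative
`n · (G^I_{λ(μ₂)})^{n+1} g(t)` at every `μ₂ > −1`. -/
theorem hasDerivAt_iterate_mu (n : ℕ) {μ₂ : ℝ} (hμ₂ : -1 < μ₂) {t : ℝ} (ht : 0 < t) :
    HasDerivAt (fun μ => ((greenSolI (fun t => sph (1 + Real.sqrt (μ + 1)) (hyp t))
        (sphDecay (1 + Real.sqrt (μ + 1))))^[n] g) t)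
      (n * ((greenSolI (fun t => sph (1 + Real.sqrt (μ₂ + 1)) (hyp t))
        (sphDecay (1 + Real.sqrt (μ₂ + 1))))^[n + 1] g) t) μ₂ := by
  set lam₂ := 1 + Real.sqrt (μ₂ + 1) with hlam₂def
  have hlam₂ : 1 < lam₂ := one_lt_one_add_sqrt hμ₂
  have hinner := hasDerivAt_one_add_sqrt hμ₂
  have houter := hasDerivAt_iterate_lam hlam₂ hg hD n ht
  have hcomp := houter.comp μ₂ hinner
  refine hcomp.congr_deriv ?_
  -- `(2λ₂ − 2) · 1/(2√(μ₂ + 1)) = 1` since `λ₂ − 1 = √(μ₂ + 1)`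
  have hsqrt : Real.sqrt (μ₂ + 1) = lam₂ - 1 := by rw [hlam₂def]; ring
  have hpos : 0 < Real.sqrt (μ₂ + 1) := Real.sqrt_pos.mpr (by linarith)
  have h2 : 2 * Real.sqrt (μ₂ + 1) ≠ 0 := by positivity
  rw [show (2 * lam₂ - 2) = 2 * Real.sqrt (μ₂ + 1) by rw [hsqrt]; ring, mul_one_div,
    mul_div_cancel_left₀ _ h2]

include hg hD in
/-- **THE ITERATED DERIVATIVES OF THE RESOLVENT**: `iteratedDeriv k (μ ↦ G^I_{λ(μ)} g(t)) μ₂ = k! · (G^I_{λ(μ₂)})^{k+1} g(t)`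
for every `k` and `μ₂ > −1` — `dᵏ/dμᵏ (L − μ)⁻¹ g = k! (L − μ)^{−k−1} g` on `W_1`. -/
theorem iteratedDeriv_resolvent_mu (k : ℕ) {μ₂ : ℝ} (hμ₂ : -1 < μ₂) {t : ℝ} (ht : 0 < t) :
    iteratedDeriv k (fun μ => greenSolI (fun t => sph (1 + Real.sqrt (μ + 1)) (hyp t))
        (sphDecay (1 + Real.sqrt (μ + 1))) g t) μ₂
      = (k.factorial : ℝ) * ((greenSolI (fun t => sph (1 + Real.sqrt (μ₂ + 1)) (hyp t))
        (sphDecay (1 + Real.sqrt (μ₂ + 1))))^[k + 1] g) t := by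
  -- the statement for every `μ₂ > −1` at once, by induction on `k`
  suffices h : ∀ μ₂ : ℝ, -1 < μ₂ → iteratedDeriv k (fun μ => greenSolI (fun t => sph (1 + Real.sqrt (μ + 1)) (hyp t))
        (sphDecay (1 + Real.sqrt (μ + 1))) g t) μ₂
      = (k.factorial : ℝ) * ((greenSolI (fun t => sph (1 + Real.sqrt (μ₂ + 1)) (hyp t))
        (sphDecay (1 + Real.sqrt (μ₂ + 1))))^[k + 1] g) t from h μ₂ hμ₂
  induction k with
  | zero =>
    intro μ₂ _
    simp
  | succ k ih =>
    intro μ₂ hμ₂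
    rw [iteratedDeriv_succ]
    -- on the neighbourhood `(−1, ∞)` of `μ₂` the `k`-th derivative is `k! (G^I)^{k+1} g(t)`
    have hev : (iteratedDeriv k (fun μ => greenSolI (fun t => sph (1 + Real.sqrt (μ + 1)) (hyp t))
          (sphDecay (1 + Real.sqrt (μ + 1))) g t))
        =ᶠ[𝓝 μ₂] fun μ => (k.factorial : ℝ) * ((greenSolI (fun t => sph (1 + Real.sqrt (μ + 1)) (hyp t))
          (sphDecay (1 + Real.sqrt (μ + 1))))^[k + 1] g) t := by
      filter_upwards [eventually_gt_nhds hμ₂] with μ hμ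
      exact ih μ hμ
    rw [hev.deriv_eq]
    have hd := (hasDerivAt_iterate_mu hg hD (k + 1) hμ₂ ht).const_mul (k.factorial : ℝ)
    rw [hd.deriv]
    push_cast [Nat.factorial_succ]
    ring

include hg hD in
/-- The iterated derivatives at `μ₂ = λ₂(λ₂ − 2)`, `λ₂ > 1`:
`iteratedDeriv k (μ ↦ G^I_{λ(μ)} g(t)) (λ₂(λ₂ − 2)) = k! · (G^I_{λ₂})^{k+1} g(t)`. -/
theorem iteratedDeriv_resolvent_mu' (k : ℕ) {lam₂ : ℝ} (hlam₂ : 1 < lam₂) {t : ℝ} (ht : 0 < t) :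
    iteratedDeriv k (fun μ => greenSolI (fun t => sph (1 + Real.sqrt (μ + 1)) (hyp t))
        (sphDecay (1 + Real.sqrt (μ + 1))) g t) (lam₂ * (lam₂ - 2))
      = (k.factorial : ℝ) * ((greenSolI (fun t => sph lam₂ (hyp t)) (sphDecay lam₂))^[k + 1] g) t := by
  have hμ₂ : -1 < lam₂ * (lam₂ - 2) := by nlinarith
  rw [iteratedDeriv_resolvent_mu hg hD k hμ₂ ht, one_add_sqrt_eq hlam₂]

end measure

end Summit.Ventures.HodgeRepro2.T5SU11ResolventIteratedDerivative
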